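import Summits.BirchSwinnertonDyer.BirchSwinnertonDyer.Theorems.SignedLowerHalvesSmallImageLowerHalfBothSignsRttLineClosing
import Summits.BirchSwinnertonDyer.BirchSwinnertonDyer.Theorems.SignedLowerHalvesSmallImageLowerHalfBothSignsRttFloorCert
import Summits.BirchSwinnertonDyer.BirchSwinnertonDyer.Theorems.SignedLowerHalvesSmallImageLowerHalfBothSignsRttTierUnitRecords03
import Summits.BirchSwinnertonDyer.BirchSwinnertonDyer.Theorems.SignedLowerHalvesSmallImageLowerHalfBothSignsRttSplitCloserRecords02
import Summits.BirchSwinnertonDyer.Rank1Residual.X9.ChaDescentRecords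
import Literature.NumberTheory.EllipticCurves.IsogenyHasCMIffJMemProofs
import HarnessLib

/-!
# Route `SignedLowerHalves`, crux L `SmallImageLowerHalfBothSigns` (item stmt-BirchSwinnertonDyer-23599), line `rtt_w3` v48:
# PER-PAIR RECORDS at `p = 11` and `p = 7` — Kobayashi's SIGNED MAIN CONJECTURE (certified sign) and lower divisibility (both signs)
# for `232544f1 @ 11` and `245456b1 @ 7`, BY NAME from P6's closing file + ONE displayed two-engine Mazur–Tate row, NO partner

One-shot seat `bsd-line-k3-pairs-p1` g0 (director-bsd g27 (1008)(a); LEAD `cruxlead-stmt-BirchSwinnertonDyer-23599` g17's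
`SCOPE-perpair-g17.md` d2f543dbac698fca §3–§4, option (b1)); `--supports stmt-BirchSwinnertonDyer-23599 --as helper`; THEOREMS ONLY
(no `def`, no instance, no notation, no named fact introduced, no `sorry`, no `native_decide`); count-neutral.

HONEST STATUS (verbatim sense of the head). Every ★ theorem below is a PER-PAIR CONDITIONAL RECORD: the FULL signed main conjecture
`KobayashiMainConjecture W p ε₀` (certified sign `ε₀`) — resp. Kobayashi's lower divisibility for both signs — for THIS curve at THIS
`p`, modulo (i) the 22 typed print facts of crux L's cite stub (the hypotheses `hJ … hRes` of P6's
`SmallImageRttLine.kobayashiMainConjecture_of_prints_of_oneSignFloorAt`, file `…RttLineClosing`, p836246; TYPED ≠ PROVED), (ii) ONE displayed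
two-engine Mazur–Tate row `hrow` of the pair, and (iii) ONE displayed image datum `hNS : ¬ Surj W p` (option (b1): the mod-`p` image of these
curves is the normaliser of a non-split Cartan — a non-CM rational point of `X_ns⁺(p)` — and the tree has no partner-free certificate for it
at `p ∈ {7, 11}`; Zywina's `J₇` criterion / Chen–Cummins' `X_ns⁺(11)` table are NOT typed here). These are the first per-curve SIGNED MAIN
CONJECTURE records at `p = 7` and at `p = 11` ON THE SMALL-IMAGE CLASS (`¬ Surj`, crux L's class) — the tree's existing per-curve
`KobayashiMainConjecture W 7 ε` / `W 11 ε` theorems (53 resp. 111 decls, files `…KobayashiLowerHalfLargeImageMazurTateRecordsNN`, e.g.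
`kobayashiMainConjecture_x7r1mt_394350cf1_7`) all carry `hsurj : Surj W p` (large image, crux 3) — and the first partner-free per-curve road on
that class (no rational CM partner, no `BSD_p`, no exact-descent certificate, no rank / `L`-value binder); they close NOTHING class-wide: item
23599, crux L (class-wide, all `p`), crux M and BSD remain OPEN; BSD is proved for NO curve by this file.

COMPOSITION, all BY NAME. ★ `kobayashiMainConjecture_c<label>_<p>_of_prints_of_mazurTateRow` := P6's
`SmallImageRttLine.kobayashiMainConjecture_of_prints_of_oneSignFloorAt (22 prints) W p hp2 hX hCM hap hNS 1 hfl` with the one-sign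
certificate `hfl` := `SmallImageRttOneSided.oneSignFloor_of_mazurTateRowEven W p hp2 hgood hap (Even 2) hrow` (file `…RttFloorCert` §2,
IMAGE-FREE, PARTNER-FREE: Pollack 2003 Prop. 6.9/6.10/6.18 turn the row into `(μ, λ)(L⁺_p) = (0, l)`, Cor. 5.11 gives `L⁺_p ≠ 0`, hence unit
content); the `ε₀ = −1` twin uses `…oneSignFloor_of_mazurTateRowOdd` at the ODD layer `1`; the both-signs corollary is sign idleness on X7
(`SignDefect.X7.exists_kobayashiLowerDivisibility_iff_forall`, Kobayashi (7.21)) with the two period facts fed by the TREE THEOREMS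
`Theorems.realPeriodRat_eq_unit_mul_plusPeriod(_three)_holds`. Kernel-decided per pair by the tree's existing patterns only: `p ∤ Δ_min`
(`hasGoodReductionAtPrime_of_not_dvd`, `decide +kernel`), `a_p = 0` (`frobeniusTrace_eq` + the landed point counts `card_u232544f1_11`
(…RttTierUnitRecords03) / `card_t245456b1_7` (…RttSplitCloserRecords02)), an additive prime (`not_semistable_of_intModel`, X7), `j(W) ∉` the
thirteen CM `j`-invariants (`hasCM_iff_j_mem_holds` + `X9.j_eq_of_intModel` + `decide +kernel`).

SOURCE OF THE ROWS (displayed, not kernel): the crux's standing disprover's kit j335262 (`cdisprove-stmt-BirchSwinnertonDyer-23599` g0, PREREG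
`gvkan2` 839c353487edc3e8; table of record `pub/bsd-ssimc/cdisprove-stmt-BirchSwinnertonDyer-23599/gvkan2/LAYERS.tsv` sha16 09c04126f37ca31c,
`MUONESIGN.tsv` b6f406fadb903af2 verdict `UNIT-BOTH`; evidence #53–#56 of 2026-08-29 on the item), TWO engines per row, status `2eng`, 0
disagreements in `(μ, λ)`: engine B = `msengine` (numerical modular symbols + integrality certificate, `symbols_ok`) + `iwlayer`, engine
E = `eclib` exact modular symbols. Table level `n` ↦ tree / Pollack index `n − 1`. Normalisation: the engines use Cremona's `Ω`, the tree's
`mazurTateElement` uses `plusPeriod f`; the `∃ Θ`-form of `hrow` (`Θ ≠ 0`, `μ`, `λ`) is invariant under the `p`-adic-unit ratio, which at good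
`p ≥ 5` is the tree theorem `realPeriodRat_eq_unit_mul_plusPeriod_holds`.

References: [Kobayashi2003] Conjecture (p. 2), Thm. 1.2, 4.1, 7.4; [Pollack2003] Prop. 6.9, 6.10, 6.18, Cor. 5.11, Conj. 6.3;
[PollackWeston2011MT] §3.1, Thm. 4.1; [BDKim2009] Cor. 2.13; [PollackRubin2004] Theorem (p. 448); [GreenbergVatsal2000] §3 Rem. 3.4;
[Cremona2006] Table 1 (labels 232544f1, 245456b1); [SilvermanAEC2009] VII.5 Prop. 5.1, App. C §11.
-/

set_option autoImplicit false
-- D-0017: single-problem summit, the namespace repeats the problem name by design.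
set_option linter.dupNamespace false
noncomputable section

open scoped Classical MatrixGroups ModularForm

open CongruenceSubgroup WeierstrassCurve Literature.NumberTheory.EllipticCurves
  Literature.NumberTheory.EllipticCurves.ModularForms
  Literature.NumberTheory.EllipticCurves.Kobayashi2003 ZpExtension
  Literature.NumberTheory.EllipticCurves.GreenbergVatsal2000
  Literature.NumberTheory.EllipticCurves.Rank1Residual
  Literature.NumberTheory.EllipticCurves.Rank1Residual.Typed
  Literature.NumberTheory.EllipticCurves.Rank1Residual.X11RankOneCertificates
  Literature.NumberTheory.IwasawaTheory
  Summit.BirchSwinnertonDyer.BirchSwinnertonDyer.Rank1Residual.IntModel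
  Summit.BirchSwinnertonDyer.BirchSwinnertonDyer.Rank1Residual.X11RankOne
  Summit.BirchSwinnertonDyer.Rank1Residual.X11b
  Summit.BirchSwinnertonDyer.Rank1Residual.X1
  Summit.BirchSwinnertonDyer.Rank1Residual.X1.MuLambda
  Summit.BirchSwinnertonDyer.Rank1Residual.Supersingular
  Summit.BirchSwinnertonDyer.BirchSwinnertonDyer.Theorems

namespace Summit.BirchSwinnertonDyer.BirchSwinnertonDyer.Theorems.SmallImageRttLine

/-! ## §1 Kernel-decided inputs of the two pairs (class X7, `a_p = 0`, non-CM) -/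

/-- **Kernel data of `232544f1 @ 11`** (Cremona's minimal model `[0, 0, 0, −1129345880, −86028258620304]`, `N = 232544 = 2⁵·13²·43`): `ClassX7 W 11`
(`11 ∤ Δ_min`; `#Ẽ(𝔽₁₁) = 12` by the landed count `card_u232544f1_11`, so `a₁₁ = 0`; additive at `13`: `13 ∣ Δ, c₄`), `a₁₁ = 0`, and `W` is non-CM
(`j = c₄³/Δ ∉ cmJInvariants`, kernel). [cite: Cremona2006, Table 1 (Cremona label 232544f1)] [cite: SilvermanAEC2009, VII.5 Prop. 5.1 and App. C §11] -/
theorem classX7_frobeniusTrace_not_hasCM_c232544f1_11 (W : WeierstrassCurve ℚ) [W.IsElliptic] [W.IsGloballyMinimal]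
    [Fact (Nat.Prime 11)] (hW : W = ⟨0, 0, 0, -1129345880, -86028258620304⟩) :
    ClassX7 W 11 ∧ W.frobeniusTrace 11 = 0 ∧ ¬ W.HasCM := by
  have hIW : integralModelInt W = ⟨0, 0, 0, -1129345880, -86028258620304⟩ :=
    integralModelInt_eq_of_map_eq _ (by rw [hW]; ext <;> simp [WeierstrassCurve.map])
  have hΔ : (⟨0, 0, 0, -1129345880, -86028258620304⟩ : WeierstrassCurve ℤ).Δ = discOf [0, 0, 0, -1129345880, -86028258620304] :=
    intCurve_Δ 0 0 0 (-1129345880) (-86028258620304)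
  have hc₄ : (⟨0, 0, 0, -1129345880, -86028258620304⟩ : WeierstrassCurve ℤ).c₄ = c4Of [0, 0, 0, -1129345880, -86028258620304] :=
    intCurve_c₄ 0 0 0 (-1129345880) (-86028258620304)
  have hgood : W.HasGoodReductionAtPrime 11 :=
    hasGoodReductionAtPrime_of_not_dvd W 11 (by rw [minimalDiscriminantInt_eq hIW, hΔ]; decide +kernel)
  have hap : W.frobeniusTrace 11 = 0 := by rw [frobeniusTrace_eq hIW SmallImageRttOneSided.card_u232544f1_11]; norm_num
  have hX : ClassX7 W 11 :=
    ⟨⟨hgood, by rw [hap]; exact dvd_zero _⟩, not_semistable_of_intModel hIW 13 (by norm_num) (by rw [hΔ]; decide +kernel)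
      (by rw [hc₄]; decide +kernel)⟩
  have hcm : ¬ W.HasCM := fun h ↦ by
    have hj := (hasCM_iff_j_mem_holds W).mp h
    rw [Summit.BirchSwinnertonDyer.Rank1Residual.X9.j_eq_of_intModel 0 0 0 (-1129345880) (-86028258620304) hIW] at hj
    exact absurd hj (by decide +kernel)
  exact ⟨hX, hap, hcm⟩

/-- **Kernel data of `245456b1 @ 7`** (Cremona's minimal model `[0, 1, 0, −85980133, 623470851987]`, `N = 245456 = 2⁴·23²·29`): `ClassX7 W 7`
(`7 ∤ Δ_min`; `#Ẽ(𝔽₇) = 8` by the landed count `card_t245456b1_7`, so `a₇ = 0`; additive at `23`: `23 ∣ Δ, c₄`), `a₇ = 0`, and `W` is non-CM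
(`j = c₄³/Δ ∉ cmJInvariants`, kernel). [cite: Cremona2006, Table 1 (Cremona label 245456b1)] [cite: SilvermanAEC2009, VII.5 Prop. 5.1 and App. C §11] -/
theorem classX7_frobeniusTrace_not_hasCM_c245456b1_7 (W : WeierstrassCurve ℚ) [W.IsElliptic] [W.IsGloballyMinimal]
    [Fact (Nat.Prime 7)] (hW : W = ⟨0, 1, 0, -85980133, 623470851987⟩) :
    ClassX7 W 7 ∧ W.frobeniusTrace 7 = 0 ∧ ¬ W.HasCM := by
  have hIW : integralModelInt W = ⟨0, 1, 0, -85980133, 623470851987⟩ :=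
    integralModelInt_eq_of_map_eq _ (by rw [hW]; ext <;> simp [WeierstrassCurve.map])
  have hΔ : (⟨0, 1, 0, -85980133, 623470851987⟩ : WeierstrassCurve ℤ).Δ = discOf [0, 1, 0, -85980133, 623470851987] :=
    intCurve_Δ 0 1 0 (-85980133) 623470851987
  have hc₄ : (⟨0, 1, 0, -85980133, 623470851987⟩ : WeierstrassCurve ℤ).c₄ = c4Of [0, 1, 0, -85980133, 623470851987] :=
    intCurve_c₄ 0 1 0 (-85980133) 623470851987
  have hgood : W.HasGoodReductionAtPrime 7 :=
    hasGoodReductionAtPrime_of_not_dvd W 7 (by rw [minimalDiscriminantInt_eq hIW, hΔ]; decide +kernel)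
  have hap : W.frobeniusTrace 7 = 0 := by rw [frobeniusTrace_eq hIW SmallImageRttOneSided.card_t245456b1_7]; norm_num
  have hX : ClassX7 W 7 :=
    ⟨⟨hgood, by rw [hap]; exact dvd_zero _⟩, not_semistable_of_intModel hIW 23 (by norm_num) (by rw [hΔ]; decide +kernel)
      (by rw [hc₄]; decide +kernel)⟩
  have hcm : ¬ W.HasCM := fun h ↦ by
    have hj := (hasCM_iff_j_mem_holds W).mp h
    rw [Summit.BirchSwinnertonDyer.Rank1Residual.X9.j_eq_of_intModel 0 1 0 (-85980133) 623470851987 hIW] at hj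
    exact absurd hj (by decide +kernel)
  exact ⟨hX, hap, hcm⟩

/-! ## §2 The records (the 22 print facts of crux L's cite stub are the displayed hypotheses `hJ … hRes`, in P6's order) -/

/-! ### `232544f1 @ 11` (`N = 2⁵·13²·43`, `r_an = 0`, `a₁₁ = 0`, mod-11 image `11Nn` = normaliser of non-split Cartan, no rational CM partner) -/

/-- ★ **PER-PAIR CONDITIONAL RECORD — Kobayashi's signed main conjecture `KobayashiMainConjecture W 11 (+1)` for `232544f1` at `p = 11`**
(certified sign `ε₀ = +1`): modulo (i) the 22 typed print facts of crux L's cite stub (`hJ … hRes`, hypotheses; typed ≠ proved), (ii) ONE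
displayed two-engine Mazur–Tate row `hrow` — kit j335262 `gvkan2/LAYERS.tsv` 09c04126f37ca31c, row `232544f1@11, level 3 = Pollack index 2, even,
q = deg ω₂⁻ = 10`: `μ = 0, λ = 10 = 10 + 0`, engines B (`msengine`+`iwlayer`) and E (`eclib`) AGREE (lower rows: index 1 odd `μ = 0, λ = 0`; index 0
`μ = 0, λ = 0`, i.e. `11 ∤ L(E,1)/Ω`) ⇒ `(μ, λ)(L⁺₁₁(E)) = (0, 0)` — and (iii) ONE displayed image datum `hNS : ¬ Surj W 11` (option (b1)). BY NAME:
P6's `kobayashiMainConjecture_of_prints_of_oneSignFloorAt` ∘ `SmallImageRttOneSided.oneSignFloor_of_mazurTateRowEven`; kernel-decided: §1.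
First per-curve signed MC at `p = 11` on the SMALL-IMAGE class (`¬ Surj`; the tree's 111 `KobayashiMainConjecture W 11 ε` records are large-image,
`hsurj`) and first partner-free per-curve road there; closes nothing class-wide; 23599, crux L, crux M and BSD remain OPEN; BSD is proved for no curve. [cite: Kobayashi2003, Conjecture (p. 2), Thm. 1.2, Thm. 4.1]
[cite: Pollack2003, Prop. 6.18, Cor. 5.11] [cite: Cremona2006, Table 1 (Cremona label 232544f1)] -/
theorem kobayashiMainConjecture_c232544f1_11_of_prints_of_mazurTateRow
    (hJ : thm62_63_73_signedColemanKato_zetaJoint) (h12 : thm12_signedSelmerDual_finite_torsion) (h41 : thm41_signedCharIdeal_divisibility)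
    (hD : Hida2000_thm326_exists_galoisRep) (hC : Carayol1986_artinConductorExponent)
    (hS : ∀ (V : WeierstrassCurve ℚ) (ℓ : ℕ) [Fact ℓ.Prime], V.swanConductorAt_rationalTate_eq_wildConductorExponent_of_ringChar_eq_two ℓ)
    (hmod : exists_isNewformOf) (hKim : BDKim2009.cor213_signedLambda_add_sum_delta_eq_of_torsionIso)
    (hPR : PollackRubin2004.mainTheorem_signedCharIdeal_eq_of_cm) (hV : vatsal1999_plusSymbol_congruence)
    (hK211 : BDKim2009.prop211_selmer_noFiniteSubmodule) (hK2526 : BDKim2009.cor25_prop26_selmer_lambda_eq_add_sum_delta)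
    (h53 : Literature.NumberTheory.ComplexMultiplication.EllipticUnits.JohnsonLeungKings2011.cor53_thm52ShapeO) (hKE : Literature.NumberTheory.ComplexMultiplication.EllipticUnits.Kato2004.sec155_exists_katoUnitRep)
    (h24i : Literature.NumberTheory.ComplexMultiplication.EllipticUnits.DeShalit1987.prop24_i_mem_rayClassField) (h24ii : Literature.NumberTheory.ComplexMultiplication.EllipticUnits.DeShalit1987.prop24_ii_galoisAction)
    (h25 : Literature.NumberTheory.ComplexMultiplication.EllipticUnits.DeShalit1987.prop25_i_normRelation)
    (hKP : KimPark2017.prop212_prop33_localSignedDual_free_rank_two) (hKPd : KimPark2017.def210_prop212_exists_signedNormSystem)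
    (hKP29 : KimPark2017.def210_prop29_exists_signedNormSystem_logSum)
    (hF1 : Literature.NumberTheory.EllipticCurves.Kato2004.CM.prop159_ellipticUnits_tatePairing_values_inert)
    (hRes : Literature.NumberTheory.EllipticCurves.ModularForms.Ribet1977_cmNewform_gamma0_badEulerFactor_padicCharacter)
    (W : WeierstrassCurve ℚ) [W.IsElliptic] [W.IsGloballyMinimal] [Fact (Nat.Prime 11)]
    (hW : W = ⟨0, 0, 0, -1129345880, -86028258620304⟩) (hNS : ¬ W.HasSurjectiveModNGaloisRep 11)
    (hrow : ∀ [NeZero (W.conductorNorm ℤ)] (f : CuspForm (Gamma0 (W.conductorNorm ℤ)) 2), IsNewformOf W f →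
      ∃ Θ : IwasawaAlgebra 11, iwasawaToPowerSeries 11 Θ =
          ((mazurTateElement f 11 2).map (algebraMap ℚ ℚ_[11]) : PowerSeries ℚ_[11]) ∧
        Θ ≠ 0 ∧ mu Θ = 0 ∧ lam Θ = (cyclotomicOmegaMinus 11 2).natDegree + 0) :
    KobayashiMainConjecture W 11 1 := by
  obtain ⟨hX, hap, hcm⟩ := classX7_frobeniusTrace_not_hasCM_c232544f1_11 W hW
  exact kobayashiMainConjecture_of_prints_of_oneSignFloorAt hJ h12 h41 hD hC hS hmod hKim hPR hV hK211 hK2526 h53 hKE h24i h24ii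
    h25 hKP hKPd hKP29 hF1 hRes W 11 (by norm_num) hX hcm hap hNS 1
    (fun f hf Lplus Lminus hPP ↦ SmallImageRttOneSided.oneSignFloor_of_mazurTateRowEven W 11 (by norm_num) hX.1.1 hap
      (by decide : Even 2) hrow f hf Lplus Lminus hPP)

/-- ★ **Both signs: Kobayashi's lower divisibility `∀ ε, KobayashiLowerDivisibility W 11 ε` for `232544f1` at `p = 11`** (crux L's body AT THE PAIR)
from the same inputs (22 prints, the EVEN row `hrow`, `hNS`): the `ε₀ = +1` main conjecture above, its Eisenstein half, and sign idleness on X7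
(`SignDefect.X7.exists_kobayashiLowerDivisibility_iff_forall`, period facts := the tree theorems `realPeriodRat_eq_unit_mul_plusPeriod(_three)_holds`).
Per pair; CONDITIONAL; closes nothing class-wide; BSD is proved for no curve. [cite: Kobayashi2003, Conjecture (p. 2), Thm. 7.4 (p. 13)]
[cite: Pollack2003, Prop. 6.18] [cite: Cremona2006, Table 1 (Cremona label 232544f1)] -/
theorem forall_kobayashiLowerDivisibility_c232544f1_11_of_prints_of_mazurTateRow
    (hJ : thm62_63_73_signedColemanKato_zetaJoint) (h12 : thm12_signedSelmerDual_finite_torsion) (h41 : thm41_signedCharIdeal_divisibility)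
    (hD : Hida2000_thm326_exists_galoisRep) (hC : Carayol1986_artinConductorExponent)
    (hS : ∀ (V : WeierstrassCurve ℚ) (ℓ : ℕ) [Fact ℓ.Prime], V.swanConductorAt_rationalTate_eq_wildConductorExponent_of_ringChar_eq_two ℓ)
    (hmod : exists_isNewformOf) (hKim : BDKim2009.cor213_signedLambda_add_sum_delta_eq_of_torsionIso)
    (hPR : PollackRubin2004.mainTheorem_signedCharIdeal_eq_of_cm) (hV : vatsal1999_plusSymbol_congruence)
    (hK211 : BDKim2009.prop211_selmer_noFiniteSubmodule) (hK2526 : BDKim2009.cor25_prop26_selmer_lambda_eq_add_sum_delta)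
    (h53 : Literature.NumberTheory.ComplexMultiplication.EllipticUnits.JohnsonLeungKings2011.cor53_thm52ShapeO) (hKE : Literature.NumberTheory.ComplexMultiplication.EllipticUnits.Kato2004.sec155_exists_katoUnitRep)
    (h24i : Literature.NumberTheory.ComplexMultiplication.EllipticUnits.DeShalit1987.prop24_i_mem_rayClassField) (h24ii : Literature.NumberTheory.ComplexMultiplication.EllipticUnits.DeShalit1987.prop24_ii_galoisAction)
    (h25 : Literature.NumberTheory.ComplexMultiplication.EllipticUnits.DeShalit1987.prop25_i_normRelation)
    (hKP : KimPark2017.prop212_prop33_localSignedDual_free_rank_two) (hKPd : KimPark2017.def210_prop212_exists_signedNormSystem)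
    (hKP29 : KimPark2017.def210_prop29_exists_signedNormSystem_logSum)
    (hF1 : Literature.NumberTheory.EllipticCurves.Kato2004.CM.prop159_ellipticUnits_tatePairing_values_inert)
    (hRes : Literature.NumberTheory.EllipticCurves.ModularForms.Ribet1977_cmNewform_gamma0_badEulerFactor_padicCharacter)
    (W : WeierstrassCurve ℚ) [W.IsElliptic] [W.IsGloballyMinimal] [Fact (Nat.Prime 11)]
    (hW : W = ⟨0, 0, 0, -1129345880, -86028258620304⟩) (hNS : ¬ W.HasSurjectiveModNGaloisRep 11)
    (hrow : ∀ [NeZero (W.conductorNorm ℤ)] (f : CuspForm (Gamma0 (W.conductorNorm ℤ)) 2), IsNewformOf W f →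
      ∃ Θ : IwasawaAlgebra 11, iwasawaToPowerSeries 11 Θ =
          ((mazurTateElement f 11 2).map (algebraMap ℚ ℚ_[11]) : PowerSeries ℚ_[11]) ∧
        Θ ≠ 0 ∧ mu Θ = 0 ∧ lam Θ = (cyclotomicOmegaMinus 11 2).natDegree + 0) :
    ∀ ε : ℤˣ, KobayashiLowerDivisibility W 11 ε := by
  obtain ⟨hX, hap, -⟩ := classX7_frobeniusTrace_not_hasCM_c232544f1_11 W hW
  have hMC := kobayashiMainConjecture_c232544f1_11_of_prints_of_mazurTateRow hJ h12 h41 hD hC hS hmod hKim hPR hV hK211 hK2526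
    h53 hKE h24i h24ii h25 hKP hKPd hKP29 hF1 hRes W hW hNS hrow
  exact fun ε ↦ (SignDefect.X7.exists_kobayashiLowerDivisibility_iff_forall W 11 h12
    Summit.BirchSwinnertonDyer.BirchSwinnertonDyer.Theorems.realPeriodRat_eq_unit_mul_plusPeriod_holds
    Summit.BirchSwinnertonDyer.BirchSwinnertonDyer.Theorems.realPeriodRat_eq_unit_mul_plusPeriod_three_holds hJ (by norm_num) hX hap).mp
    ⟨1, kobayashiLowerDivisibility_of_mainConjecture hMC⟩ ε

/-- ★ **The `ε₀ = −1` twin for `232544f1 @ 11`: `KobayashiMainConjecture W 11 (−1)`** from the 22 prints, `hNS`, and ONE displayed ODD row `hrowO` —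
`LAYERS.tsv` 09c04126f37ca31c row `232544f1@11, level 2 = Pollack index 1, odd, q = deg ω₁⁺ = 0`: `μ = 0, λ = 0 = 0 + 0`, engines B and E AGREE ⇒
`(μ, λ)(L⁻₁₁(E)) = (0, 0)`; BY NAME via `SmallImageRttOneSided.oneSignFloor_of_mazurTateRowOdd`. Per pair; CONDITIONAL; closes nothing class-wide;
BSD is proved for no curve. [cite: Kobayashi2003, Conjecture (p. 2), Thm. 1.2, Thm. 4.1] [cite: Pollack2003, Prop. 6.18, Cor. 5.11]
[cite: Cremona2006, Table 1 (Cremona label 232544f1)] -/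
theorem kobayashiMainConjecture_c232544f1_11_neg_one_of_prints_of_mazurTateRow
    (hJ : thm62_63_73_signedColemanKato_zetaJoint) (h12 : thm12_signedSelmerDual_finite_torsion) (h41 : thm41_signedCharIdeal_divisibility)
    (hD : Hida2000_thm326_exists_galoisRep) (hC : Carayol1986_artinConductorExponent)
    (hS : ∀ (V : WeierstrassCurve ℚ) (ℓ : ℕ) [Fact ℓ.Prime], V.swanConductorAt_rationalTate_eq_wildConductorExponent_of_ringChar_eq_two ℓ)
    (hmod : exists_isNewformOf) (hKim : BDKim2009.cor213_signedLambda_add_sum_delta_eq_of_torsionIso)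
    (hPR : PollackRubin2004.mainTheorem_signedCharIdeal_eq_of_cm) (hV : vatsal1999_plusSymbol_congruence)
    (hK211 : BDKim2009.prop211_selmer_noFiniteSubmodule) (hK2526 : BDKim2009.cor25_prop26_selmer_lambda_eq_add_sum_delta)
    (h53 : Literature.NumberTheory.ComplexMultiplication.EllipticUnits.JohnsonLeungKings2011.cor53_thm52ShapeO) (hKE : Literature.NumberTheory.ComplexMultiplication.EllipticUnits.Kato2004.sec155_exists_katoUnitRep)
    (h24i : Literature.NumberTheory.ComplexMultiplication.EllipticUnits.DeShalit1987.prop24_i_mem_rayClassField) (h24ii : Literature.NumberTheory.ComplexMultiplication.EllipticUnits.DeShalit1987.prop24_ii_galoisAction)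
    (h25 : Literature.NumberTheory.ComplexMultiplication.EllipticUnits.DeShalit1987.prop25_i_normRelation)
    (hKP : KimPark2017.prop212_prop33_localSignedDual_free_rank_two) (hKPd : KimPark2017.def210_prop212_exists_signedNormSystem)
    (hKP29 : KimPark2017.def210_prop29_exists_signedNormSystem_logSum)
    (hF1 : Literature.NumberTheory.EllipticCurves.Kato2004.CM.prop159_ellipticUnits_tatePairing_values_inert)
    (hRes : Literature.NumberTheory.EllipticCurves.ModularForms.Ribet1977_cmNewform_gamma0_badEulerFactor_padicCharacter)
    (W : WeierstrassCurve ℚ) [W.IsElliptic] [W.IsGloballyMinimal] [Fact (Nat.Prime 11)]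
    (hW : W = ⟨0, 0, 0, -1129345880, -86028258620304⟩) (hNS : ¬ W.HasSurjectiveModNGaloisRep 11)
    (hrowO : ∀ [NeZero (W.conductorNorm ℤ)] (f : CuspForm (Gamma0 (W.conductorNorm ℤ)) 2), IsNewformOf W f →
      ∃ Θ : IwasawaAlgebra 11, iwasawaToPowerSeries 11 Θ =
          ((mazurTateElement f 11 1).map (algebraMap ℚ ℚ_[11]) : PowerSeries ℚ_[11]) ∧
        Θ ≠ 0 ∧ mu Θ = 0 ∧ lam Θ = (cyclotomicOmegaPlus 11 1).natDegree + 0) :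
    KobayashiMainConjecture W 11 (-1) := by
  obtain ⟨hX, hap, hcm⟩ := classX7_frobeniusTrace_not_hasCM_c232544f1_11 W hW
  exact kobayashiMainConjecture_of_prints_of_oneSignFloorAt hJ h12 h41 hD hC hS hmod hKim hPR hV hK211 hK2526 h53 hKE h24i h24ii
    h25 hKP hKPd hKP29 hF1 hRes W 11 (by norm_num) hX hcm hap hNS (-1)
    (fun f hf Lplus Lminus hPP ↦ SmallImageRttOneSided.oneSignFloor_of_mazurTateRowOdd W 11 (by norm_num) hX.1.1 hap
      (by decide : Odd 1) hrowO f hf Lplus Lminus hPP)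

/-! ### `245456b1 @ 7` (`N = 2⁴·23²·29`, `r_an = 0`, `a₇ = 0`, mod-7 image `7Nn` = normaliser of non-split Cartan, no rational CM partner) -/

/-- ★ **PER-PAIR CONDITIONAL RECORD — Kobayashi's signed main conjecture `KobayashiMainConjecture W 7 (+1)` for `245456b1` at `p = 7`**
(certified sign `ε₀ = +1`): modulo (i) the 22 typed print facts of crux L's cite stub (`hJ … hRes`, hypotheses; typed ≠ proved), (ii) ONE
displayed two-engine Mazur–Tate row `hrow` — kit j335262 `gvkan2/LAYERS.tsv` 09c04126f37ca31c, row `245456b1@7, level 3 = Pollack index 2, even,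
q = deg ω₂⁻ = 6`: `μ = 0, λ = 8 = 6 + 2`, engines B (`msengine`+`iwlayer`) and E (`eclib`) AGREE (lower rows: index 1 odd `μ = 0, λ = 2`; index 0
`μ = 1`, i.e. `7 ∣ L(E,1)/Ω = 14`) ⇒ `(μ, λ)(L⁺₇(E)) = (0, 2)` — and (iii) ONE displayed image datum `hNS : ¬ Surj W 7` (option (b1)). BY NAME:
P6's `kobayashiMainConjecture_of_prints_of_oneSignFloorAt` ∘ `SmallImageRttOneSided.oneSignFloor_of_mazurTateRowEven`; kernel-decided: §1.
First per-curve signed MC at `p = 7` on the SMALL-IMAGE class (`¬ Surj`; the tree's 53 `KobayashiMainConjecture W 7 ε` records are large-image,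
`hsurj`) and first partner-free per-curve road there; closes nothing class-wide; 23599, crux L, crux M and BSD remain OPEN; BSD is proved for no curve. [cite: Kobayashi2003, Conjecture (p. 2), Thm. 1.2, Thm. 4.1]
[cite: Pollack2003, Prop. 6.18, Cor. 5.11] [cite: Cremona2006, Table 1 (Cremona label 245456b1)] -/
theorem kobayashiMainConjecture_c245456b1_7_of_prints_of_mazurTateRow
    (hJ : thm62_63_73_signedColemanKato_zetaJoint) (h12 : thm12_signedSelmerDual_finite_torsion) (h41 : thm41_signedCharIdeal_divisibility)
    (hD : Hida2000_thm326_exists_galoisRep) (hC : Carayol1986_artinConductorExponent)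
    (hS : ∀ (V : WeierstrassCurve ℚ) (ℓ : ℕ) [Fact ℓ.Prime], V.swanConductorAt_rationalTate_eq_wildConductorExponent_of_ringChar_eq_two ℓ)
    (hmod : exists_isNewformOf) (hKim : BDKim2009.cor213_signedLambda_add_sum_delta_eq_of_torsionIso)
    (hPR : PollackRubin2004.mainTheorem_signedCharIdeal_eq_of_cm) (hV : vatsal1999_plusSymbol_congruence)
    (hK211 : BDKim2009.prop211_selmer_noFiniteSubmodule) (hK2526 : BDKim2009.cor25_prop26_selmer_lambda_eq_add_sum_delta)
    (h53 : Literature.NumberTheory.ComplexMultiplication.EllipticUnits.JohnsonLeungKings2011.cor53_thm52ShapeO) (hKE : Literature.NumberTheory.ComplexMultiplication.EllipticUnits.Kato2004.sec155_exists_katoUnitRep)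
    (h24i : Literature.NumberTheory.ComplexMultiplication.EllipticUnits.DeShalit1987.prop24_i_mem_rayClassField) (h24ii : Literature.NumberTheory.ComplexMultiplication.EllipticUnits.DeShalit1987.prop24_ii_galoisAction)
    (h25 : Literature.NumberTheory.ComplexMultiplication.EllipticUnits.DeShalit1987.prop25_i_normRelation)
    (hKP : KimPark2017.prop212_prop33_localSignedDual_free_rank_two) (hKPd : KimPark2017.def210_prop212_exists_signedNormSystem)
    (hKP29 : KimPark2017.def210_prop29_exists_signedNormSystem_logSum)
    (hF1 : Literature.NumberTheory.EllipticCurves.Kato2004.CM.prop159_ellipticUnits_tatePairing_values_inert)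
    (hRes : Literature.NumberTheory.EllipticCurves.ModularForms.Ribet1977_cmNewform_gamma0_badEulerFactor_padicCharacter)
    (W : WeierstrassCurve ℚ) [W.IsElliptic] [W.IsGloballyMinimal] [Fact (Nat.Prime 7)]
    (hW : W = ⟨0, 1, 0, -85980133, 623470851987⟩) (hNS : ¬ W.HasSurjectiveModNGaloisRep 7)
    (hrow : ∀ [NeZero (W.conductorNorm ℤ)] (f : CuspForm (Gamma0 (W.conductorNorm ℤ)) 2), IsNewformOf W f →
      ∃ Θ : IwasawaAlgebra 7, iwasawaToPowerSeries 7 Θ =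
          ((mazurTateElement f 7 2).map (algebraMap ℚ ℚ_[7]) : PowerSeries ℚ_[7]) ∧
        Θ ≠ 0 ∧ mu Θ = 0 ∧ lam Θ = (cyclotomicOmegaMinus 7 2).natDegree + 2) :
    KobayashiMainConjecture W 7 1 := by
  obtain ⟨hX, hap, hcm⟩ := classX7_frobeniusTrace_not_hasCM_c245456b1_7 W hW
  exact kobayashiMainConjecture_of_prints_of_oneSignFloorAt hJ h12 h41 hD hC hS hmod hKim hPR hV hK211 hK2526 h53 hKE h24i h24ii
    h25 hKP hKPd hKP29 hF1 hRes W 7 (by norm_num) hX hcm hap hNS 1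
    (fun f hf Lplus Lminus hPP ↦ SmallImageRttOneSided.oneSignFloor_of_mazurTateRowEven W 7 (by norm_num) hX.1.1 hap
      (by decide : Even 2) hrow f hf Lplus Lminus hPP)

/-- ★ **Both signs: Kobayashi's lower divisibility `∀ ε, KobayashiLowerDivisibility W 7 ε` for `245456b1` at `p = 7`** (crux L's body AT THE PAIR)
from the same inputs (22 prints, the EVEN row `hrow`, `hNS`): the `ε₀ = +1` main conjecture above, its Eisenstein half, and sign idleness on X7
(`SignDefect.X7.exists_kobayashiLowerDivisibility_iff_forall`, period facts := the tree theorems `realPeriodRat_eq_unit_mul_plusPeriod(_three)_holds`).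
Per pair; CONDITIONAL; closes nothing class-wide; BSD is proved for no curve. [cite: Kobayashi2003, Conjecture (p. 2), Thm. 7.4 (p. 13)]
[cite: Pollack2003, Prop. 6.18] [cite: Cremona2006, Table 1 (Cremona label 245456b1)] -/
theorem forall_kobayashiLowerDivisibility_c245456b1_7_of_prints_of_mazurTateRow
    (hJ : thm62_63_73_signedColemanKato_zetaJoint) (h12 : thm12_signedSelmerDual_finite_torsion) (h41 : thm41_signedCharIdeal_divisibility)
    (hD : Hida2000_thm326_exists_galoisRep) (hC : Carayol1986_artinConductorExponent)
    (hS : ∀ (V : WeierstrassCurve ℚ) (ℓ : ℕ) [Fact ℓ.Prime], V.swanConductorAt_rationalTate_eq_wildConductorExponent_of_ringChar_eq_two ℓ)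
    (hmod : exists_isNewformOf) (hKim : BDKim2009.cor213_signedLambda_add_sum_delta_eq_of_torsionIso)
    (hPR : PollackRubin2004.mainTheorem_signedCharIdeal_eq_of_cm) (hV : vatsal1999_plusSymbol_congruence)
    (hK211 : BDKim2009.prop211_selmer_noFiniteSubmodule) (hK2526 : BDKim2009.cor25_prop26_selmer_lambda_eq_add_sum_delta)
    (h53 : Literature.NumberTheory.ComplexMultiplication.EllipticUnits.JohnsonLeungKings2011.cor53_thm52ShapeO) (hKE : Literature.NumberTheory.ComplexMultiplication.EllipticUnits.Kato2004.sec155_exists_katoUnitRep)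
    (h24i : Literature.NumberTheory.ComplexMultiplication.EllipticUnits.DeShalit1987.prop24_i_mem_rayClassField) (h24ii : Literature.NumberTheory.ComplexMultiplication.EllipticUnits.DeShalit1987.prop24_ii_galoisAction)
    (h25 : Literature.NumberTheory.ComplexMultiplication.EllipticUnits.DeShalit1987.prop25_i_normRelation)
    (hKP : KimPark2017.prop212_prop33_localSignedDual_free_rank_two) (hKPd : KimPark2017.def210_prop212_exists_signedNormSystem)
    (hKP29 : KimPark2017.def210_prop29_exists_signedNormSystem_logSum)
    (hF1 : Literature.NumberTheory.EllipticCurves.Kato2004.CM.prop159_ellipticUnits_tatePairing_values_inert)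
    (hRes : Literature.NumberTheory.EllipticCurves.ModularForms.Ribet1977_cmNewform_gamma0_badEulerFactor_padicCharacter)
    (W : WeierstrassCurve ℚ) [W.IsElliptic] [W.IsGloballyMinimal] [Fact (Nat.Prime 7)]
    (hW : W = ⟨0, 1, 0, -85980133, 623470851987⟩) (hNS : ¬ W.HasSurjectiveModNGaloisRep 7)
    (hrow : ∀ [NeZero (W.conductorNorm ℤ)] (f : CuspForm (Gamma0 (W.conductorNorm ℤ)) 2), IsNewformOf W f →
      ∃ Θ : IwasawaAlgebra 7, iwasawaToPowerSeries 7 Θ =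
          ((mazurTateElement f 7 2).map (algebraMap ℚ ℚ_[7]) : PowerSeries ℚ_[7]) ∧
        Θ ≠ 0 ∧ mu Θ = 0 ∧ lam Θ = (cyclotomicOmegaMinus 7 2).natDegree + 2) :
    ∀ ε : ℤˣ, KobayashiLowerDivisibility W 7 ε := by
  obtain ⟨hX, hap, -⟩ := classX7_frobeniusTrace_not_hasCM_c245456b1_7 W hW
  have hMC := kobayashiMainConjecture_c245456b1_7_of_prints_of_mazurTateRow hJ h12 h41 hD hC hS hmod hKim hPR hV hK211 hK2526
    h53 hKE h24i h24ii h25 hKP hKPd hKP29 hF1 hRes W hW hNS hrow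
  exact fun ε ↦ (SignDefect.X7.exists_kobayashiLowerDivisibility_iff_forall W 7 h12
    Summit.BirchSwinnertonDyer.BirchSwinnertonDyer.Theorems.realPeriodRat_eq_unit_mul_plusPeriod_holds
    Summit.BirchSwinnertonDyer.BirchSwinnertonDyer.Theorems.realPeriodRat_eq_unit_mul_plusPeriod_three_holds hJ (by norm_num) hX hap).mp
    ⟨1, kobayashiLowerDivisibility_of_mainConjecture hMC⟩ ε

/-- ★ **The `ε₀ = −1` twin for `245456b1 @ 7`: `KobayashiMainConjecture W 7 (−1)`** from the 22 prints, `hNS`, and ONE displayed ODD row `hrowO` —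
`LAYERS.tsv` 09c04126f37ca31c row `245456b1@7, level 2 = Pollack index 1, odd, q = deg ω₁⁺ = 0`: `μ = 0, λ = 2 = 0 + 2`, engines B and E AGREE ⇒
`(μ, λ)(L⁻₇(E)) = (0, 2)`; BY NAME via `SmallImageRttOneSided.oneSignFloor_of_mazurTateRowOdd`. Per pair; CONDITIONAL; closes nothing class-wide;
BSD is proved for no curve. [cite: Kobayashi2003, Conjecture (p. 2), Thm. 1.2, Thm. 4.1] [cite: Pollack2003, Prop. 6.18, Cor. 5.11]
[cite: Cremona2006, Table 1 (Cremona label 245456b1)] -/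
theorem kobayashiMainConjecture_c245456b1_7_neg_one_of_prints_of_mazurTateRow
    (hJ : thm62_63_73_signedColemanKato_zetaJoint) (h12 : thm12_signedSelmerDual_finite_torsion) (h41 : thm41_signedCharIdeal_divisibility)
    (hD : Hida2000_thm326_exists_galoisRep) (hC : Carayol1986_artinConductorExponent)
    (hS : ∀ (V : WeierstrassCurve ℚ) (ℓ : ℕ) [Fact ℓ.Prime], V.swanConductorAt_rationalTate_eq_wildConductorExponent_of_ringChar_eq_two ℓ)
    (hmod : exists_isNewformOf) (hKim : BDKim2009.cor213_signedLambda_add_sum_delta_eq_of_torsionIso)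
    (hPR : PollackRubin2004.mainTheorem_signedCharIdeal_eq_of_cm) (hV : vatsal1999_plusSymbol_congruence)
    (hK211 : BDKim2009.prop211_selmer_noFiniteSubmodule) (hK2526 : BDKim2009.cor25_prop26_selmer_lambda_eq_add_sum_delta)
    (h53 : Literature.NumberTheory.ComplexMultiplication.EllipticUnits.JohnsonLeungKings2011.cor53_thm52ShapeO) (hKE : Literature.NumberTheory.ComplexMultiplication.EllipticUnits.Kato2004.sec155_exists_katoUnitRep)
    (h24i : Literature.NumberTheory.ComplexMultiplication.EllipticUnits.DeShalit1987.prop24_i_mem_rayClassField) (h24ii : Literature.NumberTheory.ComplexMultiplication.EllipticUnits.DeShalit1987.prop24_ii_galoisAction)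
    (h25 : Literature.NumberTheory.ComplexMultiplication.EllipticUnits.DeShalit1987.prop25_i_normRelation)
    (hKP : KimPark2017.prop212_prop33_localSignedDual_free_rank_two) (hKPd : KimPark2017.def210_prop212_exists_signedNormSystem)
    (hKP29 : KimPark2017.def210_prop29_exists_signedNormSystem_logSum)
    (hF1 : Literature.NumberTheory.EllipticCurves.Kato2004.CM.prop159_ellipticUnits_tatePairing_values_inert)
    (hRes : Literature.NumberTheory.EllipticCurves.ModularForms.Ribet1977_cmNewform_gamma0_badEulerFactor_padicCharacter)
    (W : WeierstrassCurve ℚ) [W.IsElliptic] [W.IsGloballyMinimal] [Fact (Nat.Prime 7)]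
    (hW : W = ⟨0, 1, 0, -85980133, 623470851987⟩) (hNS : ¬ W.HasSurjectiveModNGaloisRep 7)
    (hrowO : ∀ [NeZero (W.conductorNorm ℤ)] (f : CuspForm (Gamma0 (W.conductorNorm ℤ)) 2), IsNewformOf W f →
      ∃ Θ : IwasawaAlgebra 7, iwasawaToPowerSeries 7 Θ =
          ((mazurTateElement f 7 1).map (algebraMap ℚ ℚ_[7]) : PowerSeries ℚ_[7]) ∧
        Θ ≠ 0 ∧ mu Θ = 0 ∧ lam Θ = (cyclotomicOmegaPlus 7 1).natDegree + 2) :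
    KobayashiMainConjecture W 7 (-1) := by
  obtain ⟨hX, hap, hcm⟩ := classX7_frobeniusTrace_not_hasCM_c245456b1_7 W hW
  exact kobayashiMainConjecture_of_prints_of_oneSignFloorAt hJ h12 h41 hD hC hS hmod hKim hPR hV hK211 hK2526 h53 hKE h24i h24ii
    h25 hKP hKPd hKP29 hF1 hRes W 7 (by norm_num) hX hcm hap hNS (-1)
    (fun f hf Lplus Lminus hPP ↦ SmallImageRttOneSided.oneSignFloor_of_mazurTateRowOdd W 7 (by norm_num) hX.1.1 hap
      (by decide : Odd 1) hrowO f hf Lplus Lminus hPP)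

end Summit.BirchSwinnertonDyer.BirchSwinnertonDyer.Theorems.SmallImageRttLine

end
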